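import Literature.NumberTheory.Sieve.Maynard2016Lemma82
import HarnessLib

/-!
# FGKMT 2018 (7.5)–(7.9) / Maynard 2016 §7: support of `y_r`, `λ_d` for the pinned `F = F_k`

Sources: K. Ford, B. Green, S. Konyagin, J. Maynard, T. Tao, *Long gaps between primes*, JAMS 31
(2018) = arXiv:1412.5029v4 [FordGreenKonyaginMaynardTao2018], (7.5)–(7.9) p. 21 («𝒟_k(𝓛) …
which contains the support ∏ dᵢ ≤ R of λ»); J. Maynard, *Dense clusters of primes in subsets*,
Compositio Math. 152 (2016) = arXiv:1405.2593 [Maynard2016DenseClusters], §7 pp. 13–14 («λ_d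
supported on d with ∏ dᵢ < R», «F supported on ∑ tᵢ ≤ 1», (7.4)) and Lemma 8.5 (proof, p. 17:
`0 ≤ F ≤ 1`).

For the pinned data `FGKMT2018.yVar/lamVar/sieveWt` with Maynard's `F = MaynardDense.F k`:

* `maynardF_le_one`, `maynardF_eq_zero_of_one_le_sum` — `0 ≤ F_k ≤ 1` on the orthant and
  `F_k(t) = 0` once `∑ tᵢ ≥ 1`;
* `sum_logVec_eq` — `∑ᵢ log rᵢ/log R = log(∏ rᵢ)/log R`;
* `yVar_F_eq_zero_of_le_prod` — `y_r = 0` when `∏ rᵢ ≥ R` (`R > 1`); `abs_yVar_F_le` — `|y_r| ≤ |P|`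
  with `P = (WB)^k/φ(WB)^k 𝔖_{WB}(𝓛)`;
* `one_le_of_mem_dkBox`, `le_floor_of_mem_dkBox`, `squarefree_of_mem_dkBox`,
  `coprime_of_mem_dkBox` — the fields of `𝒟_k(𝓛)`;
* `lamVar_F_eq_zero_of_le_prod` — `λ_d = 0` when `∏ dᵢ ≥ R` (every `r` with `dᵢ ∣ rᵢ` has
  `∏ rᵢ ≥ ∏ dᵢ`), `prod_lt_of_lamVar_F_ne_zero` — so the moduli in `w_n` satisfy `∏ dᵢ, ∏ eᵢ < R`
  and `∏ [dᵢ, eᵢ] < R²` (`prod_lcm_le_mul_prod`), the size bound used with Hypothesis 1 in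
  Propositions 9.1, 9.2, 9.4 and in Lemma 8.5;
* `card_box_filter_prod_lt_le`, `card_dkBox_filter_prod_lt_le` — `#{d : ∏ dᵢ < R} ≤ R (1 + log R)^k`
  (the count in the proof of Lemma 8.5 (iii)), via `sum_Icc_inv_le_one_add_log`.

## References
* K. Ford, B. Green, S. Konyagin, J. Maynard, T. Tao, *Long gaps between primes*, JAMS 31 (2018),
  (7.5)–(7.9) [FordGreenKonyaginMaynardTao2018].
* J. Maynard, *Dense clusters of primes in subsets*, Compositio Math. 152 (2016), §7, Lemma 8.5
  [Maynard2016DenseClusters].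
-/

noncomputable section

open Finset Filter Real

namespace Literature.NumberTheory.Sieve.FGKMT2018

variable {k : ℕ}

/-! ### `F_k` on the orthant -/

/-- `F_k ≤ 1` on the orthant (`F ≤ F₁ = ∏ g_k(tᵢ)`, `0 ≤ g_k ≤ 1`).
[cite: Maynard2016DenseClusters, Lemma 8.5, proof p. 17 («0 ≤ F ≤ 1»)] -/
theorem maynardF_le_one (hk : 2 ≤ k) {t : Fin k → ℝ} (ht : t ∈ MaynardDense.orthant k) :
    MaynardDense.F k t ≤ 1 := by
  refine (MaynardDense.F_le_F₁ hk ht).trans ?_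
  unfold MaynardDense.F₁
  exact Finset.prod_le_one (fun i _ => MaynardDense.prof_nonneg hk (MaynardDense.mem_orthant.1 ht i))
    fun i _ => MaynardDense.prof_le_one hk (MaynardDense.mem_orthant.1 ht i)

/-- `|F_k| ≤ 1` on the orthant. [cite: Maynard2016DenseClusters, Lemma 8.5, proof p. 17 («0 ≤ F ≤ 1»)] -/
theorem abs_maynardF_le_one (hk : 2 ≤ k) {t : Fin k → ℝ} (ht : t ∈ MaynardDense.orthant k) :
    |MaynardDense.F k t| ≤ 1 := by
  rw [abs_of_nonneg (MaynardDense.F_nonneg hk ht)]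
  exact maynardF_le_one hk ht

/-- `F_k(t) = 0` once `∑ tᵢ ≥ 1` (`ψ(∑ tᵢ) = 0`).
[cite: Maynard2016DenseClusters, (7.4) p. 13 («F supported on ∑ tᵢ ≤ 1»)] -/
theorem maynardF_eq_zero_of_one_le_sum {t : Fin k → ℝ} (h : 1 ≤ ∑ i, t i) :
    MaynardDense.F k t = 0 := by
  unfold MaynardDense.F
  rw [MaynardDense.psi_eq_zero h, zero_mul]

/-- `∑ᵢ log rᵢ/log R = log(∏ rᵢ)/log R` for `rᵢ ≥ 1`.
[cite: Maynard2016DenseClusters, §7 p. 13 (the substitution `tᵢ = log rᵢ/log R`)] -/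
theorem sum_logVec_eq (R : ℝ) (r : Fin k → ℕ) (hr : ∀ i, 1 ≤ r i) :
    ∑ i, Real.log (r i) / Real.log R = Real.log (∏ i, (r i : ℝ)) / Real.log R := by
  rw [← Finset.sum_div, Real.log_prod]
  intro i _
  exact_mod_cast Nat.one_le_iff_ne_zero.1 (hr i)

/-! ### Support and size of `y_r` -/

/-- `y_r = 0` when `∏ rᵢ ≥ R > 1` (then `∑ log rᵢ/log R ≥ 1` and `F_k = 0`).
[cite: Maynard2016DenseClusters, §7 pp. 13–14 («y_r supported on ∏ rᵢ < R»)] -/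
theorem yVar_F_eq_zero_of_le_prod (L : Fin k → ℤ × ℤ) (B : ℕ) {R : ℝ} (hR : 1 < R)
    (r : Fin k → ℕ) (hr : ∀ i, 1 ≤ r i) (h : R ≤ ∏ i, (r i : ℝ)) :
    yVar L B R (MaynardDense.F k) r = 0 := by
  rw [yVar_eq_mul_F L B hR.le r hr, maynardF_eq_zero_of_one_le_sum, mul_zero]
  rw [sum_logVec_eq R r hr, le_div_iff₀ (Real.log_pos hR), one_mul]
  exact Real.log_le_log (zero_lt_one.trans hR) h

/-- `|y_r| ≤ |P|`, `P = (WB)^k/φ(WB)^k 𝔖_{WB}(𝓛)` (`0 ≤ F_k ≤ 1`), for `k ≥ 2`, `R ≥ 1`, `rᵢ ≥ 1`.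
[cite: Maynard2016DenseClusters, Lemma 8.5, proof p. 17 («y_max ≪ …, 0 ≤ F ≤ 1»)] -/
theorem abs_yVar_F_le (hk : 2 ≤ k) (L : Fin k → ℤ × ℤ) (B : ℕ) {R : ℝ} (hR : 1 ≤ R)
    (r : Fin k → ℕ) (hr : ∀ i, 1 ≤ r i) :
    |yVar L B R (MaynardDense.F k) r| ≤
      |((wCut k B * B : ℕ) : ℝ) ^ k / (Nat.totient (wCut k B * B) : ℝ) ^ k *
        singSeriesExcl L (wCut k B * B)| := by
  rw [yVar_eq_mul_F L B hR r hr, abs_mul]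
  exact mul_le_of_le_one_right (abs_nonneg _)
    (abs_maynardF_le_one hk (logVec_mem_orthant hR r hr))

/-! ### The box `𝒟_k(𝓛)` -/

/-- `r ∈ 𝒟_k(𝓛) ⇒ rᵢ ≥ 1`. [cite: FordGreenKonyaginMaynardTao2018, (7.5) p. 21] -/
theorem one_le_of_mem_dkBox {L : Fin k → ℤ × ℤ} {B : ℕ} {R : ℝ} {r : Fin k → ℕ}
    (hr : r ∈ dkBox L B R) (i : Fin k) : 1 ≤ r i := by
  unfold dkBox at hr
  exact (Finset.mem_Icc.1 (Fintype.mem_piFinset.1 (Finset.mem_filter.1 hr).1 i)).1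

/-- `r ∈ 𝒟_k(𝓛) ⇒ rᵢ ≤ ⌊R⌋`. [cite: FordGreenKonyaginMaynardTao2018, (7.5) p. 21] -/
theorem le_floor_of_mem_dkBox {L : Fin k → ℤ × ℤ} {B : ℕ} {R : ℝ} {r : Fin k → ℕ}
    (hr : r ∈ dkBox L B R) (i : Fin k) : r i ≤ ⌊R⌋₊ := by
  unfold dkBox at hr
  exact (Finset.mem_Icc.1 (Fintype.mem_piFinset.1 (Finset.mem_filter.1 hr).1 i)).2

/-- `r ∈ 𝒟_k(𝓛) ⇒ μ²(∏ rᵢ) = 1`. [cite: FordGreenKonyaginMaynardTao2018, (7.5) p. 21] -/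
theorem squarefree_of_mem_dkBox {L : Fin k → ℤ × ℤ} {B : ℕ} {R : ℝ} {r : Fin k → ℕ}
    (hr : r ∈ dkBox L B R) : Squarefree (∏ i, r i) := by
  unfold dkBox at hr
  exact (Finset.mem_filter.1 hr).2.1

/-- `r ∈ 𝒟_k(𝓛) ⇒ (∏ rᵢ, WB) = 1`. [cite: FordGreenKonyaginMaynardTao2018, (7.5) p. 21] -/
theorem coprime_of_mem_dkBox {L : Fin k → ℤ × ℤ} {B : ℕ} {R : ℝ} {r : Fin k → ℕ}
    (hr : r ∈ dkBox L B R) : Nat.Coprime (∏ i, r i) (wCut k B * B) := by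
  unfold dkBox at hr
  exact (Finset.mem_filter.1 hr).2.2.1

/-! ### Support of `λ_d` -/

/-- `λ_d = 0` when `∏ dᵢ ≥ R > 1`: every `r ∈ 𝒟_k` with `dᵢ ∣ rᵢ` has `∏ rᵢ ≥ ∏ dᵢ ≥ R`,
so `y_r = 0`. [cite: Maynard2016DenseClusters, §7 p. 13 («λ_d supported on ∏ dᵢ < R»); FordGreenKonyaginMaynardTao2018, (7.5) p. 21] -/
theorem lamVar_F_eq_zero_of_le_prod (L : Fin k → ℤ × ℤ) (B : ℕ) {R : ℝ} (hR : 1 < R)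
    (d : Fin k → ℕ) (h : R ≤ ∏ i, (d i : ℝ)) :
    lamVar L B R (MaynardDense.F k) d = 0 := by
  unfold lamVar
  rw [Finset.sum_eq_zero, mul_zero]
  intro r hr
  obtain ⟨hrD, hdr⟩ := Finset.mem_filter.1 hr
  have hr1 : ∀ i, 1 ≤ r i := one_le_of_mem_dkBox hrD
  have hle : (∏ i, (d i : ℝ)) ≤ ∏ i, (r i : ℝ) := by
    have : (∏ i, d i) ≤ ∏ i, r i :=
      Finset.prod_le_prod' fun i _ => Nat.le_of_dvd (hr1 i) (hdr i)
    exact_mod_cast this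
  rw [yVar_F_eq_zero_of_le_prod L B hR r hr1 (h.trans hle), zero_div]

/-- Contrapositive: `λ_d ≠ 0 ⇒ ∏ dᵢ < R`. [cite: Maynard2016DenseClusters, §7 p. 13 («λ_d supported on ∏ dᵢ < R»)] -/
theorem prod_lt_of_lamVar_F_ne_zero (L : Fin k → ℤ × ℤ) (B : ℕ) {R : ℝ} (hR : 1 < R)
    (d : Fin k → ℕ) (h : lamVar L B R (MaynardDense.F k) d ≠ 0) :
    (∏ i, (d i : ℝ)) < R :=
  lt_of_not_ge fun hle => h (lamVar_F_eq_zero_of_le_prod L B hR d hle)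

/-- `∏ [dᵢ, eᵢ] ≤ (∏ dᵢ)(∏ eᵢ)` — with the previous lemma the moduli `∏ [dᵢ, eᵢ]` occurring in
`w_n` are `< R²`. [cite: Maynard2016DenseClusters, proof of Prop. 9.1 p. 19 («q = W∏[dᵢ,eᵢ] ≤ WR²»)] -/
theorem prod_lcm_le_mul_prod (d e : Fin k → ℕ) (hd : ∀ i, 1 ≤ d i) (he : ∀ i, 1 ≤ e i) :
    (∏ i, Nat.lcm (d i) (e i)) ≤ (∏ i, d i) * ∏ i, e i := by
  rw [← Finset.prod_mul_distrib]
  exact Finset.prod_le_prod' fun i _ =>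
    Nat.le_of_dvd (Nat.mul_pos (hd i) (he i)) (Nat.lcm_dvd_mul (d i) (e i))

/-- In the divisor sum of `w_n` only `d ∈ 𝒟_k(𝓛)` with `∏ dᵢ < R` contribute (for `F = F_k`,
`R > 1`). [cite: FordGreenKonyaginMaynardTao2018, (7.5), (7.9) p. 21 («𝒟_k … contains the support ∏ dᵢ ≤ R of λ»)] -/
theorem sum_lamVar_F_eq_sum_filter (L : Fin k → ℤ × ℤ) (B : ℕ) {R : ℝ} (hR : 1 < R)
    (P : (Fin k → ℕ) → Prop) [DecidablePred P] :
    ∑ d ∈ (dkBox L B R).filter P, lamVar L B R (MaynardDense.F k) d =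
      ∑ d ∈ ((dkBox L B R).filter P).filter (fun d => (∏ i, (d i : ℝ)) < R),
        lamVar L B R (MaynardDense.F k) d := by
  symm
  exact Finset.sum_filter_of_ne fun d _ hne => prod_lt_of_lamVar_F_ne_zero L B hR d hne


/-! ### Counting the support box: `#{d : ∏ dᵢ < R} ≤ R (1 + log R)^k` -/

/-- `∑_{1 ≤ d ≤ N} 1/d ≤ 1 + log N` (harmonic bound). [cite: Maynard2016DenseClusters, Lemma 8.5 (iii), proof p. 17 («∑_{d₁⋯d_k < R} 1/(d₁⋯d_k)»)] -/
theorem sum_Icc_inv_le_one_add_log (N : ℕ) :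
    ∑ d ∈ Finset.Icc 1 N, ((d : ℕ) : ℝ)⁻¹ ≤ 1 + Real.log N := by
  calc ∑ d ∈ Finset.Icc 1 N, ((d : ℕ) : ℝ)⁻¹ = ((harmonic N : ℚ) : ℝ) := by
        rw [harmonic_eq_sum_Icc]; push_cast; rfl
    _ ≤ 1 + Real.log N := harmonic_le_one_add_log N

/-- **[Maynard2016DenseClusters, Lemma 8.5 (iii), the count]**: the number of vectors
`d ∈ [1, ⌊R⌋]^k` with `∏ dᵢ < R` is at most `R (1 + log R)^k` (`R ≥ 1`): each such `d` has
`1 ≤ R/∏ dᵢ`, and `∑_{d ∈ [1,R]^k} 1/∏ dᵢ = (∑_{d ≤ R} 1/d)^k ≤ (1 + log R)^k`. With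
`prod_lt_of_lamVar_F_ne_zero` this bounds the number of `d ∈ 𝒟_k(𝓛)` with `λ_d ≠ 0`.
[cite: Maynard2016DenseClusters, Lemma 8.5 (iii), proof p. 17] -/
theorem card_box_filter_prod_lt_le {R : ℝ} (hR : 1 ≤ R) :
    (#((Fintype.piFinset fun _ : Fin k => Finset.Icc 1 ⌊R⌋₊).filter
        fun d => (∏ i, (d i : ℝ)) < R) : ℝ) ≤ R * (1 + Real.log R) ^ k := by
  classical
  set box := Fintype.piFinset fun _ : Fin k => Finset.Icc 1 ⌊R⌋₊ with hbox
  have hR0 : 0 < R := zero_lt_one.trans_le hR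
  -- indicator ≤ R / ∏ dᵢ on the filter
  have h1 : (#(box.filter fun d => (∏ i, (d i : ℝ)) < R) : ℝ) ≤
      ∑ d ∈ box.filter (fun d => (∏ i, (d i : ℝ)) < R), R / ∏ i, (d i : ℝ) := by
    rw [Finset.card_eq_sum_ones]; push_cast
    refine Finset.sum_le_sum fun d hd => ?_
    obtain ⟨hdb, hdR⟩ := Finset.mem_filter.1 hd
    have hpos : 0 < ∏ i, (d i : ℝ) := Finset.prod_pos fun i _ => by
      have := (Finset.mem_Icc.1 (Fintype.mem_piFinset.1 hdb i)).1
      exact_mod_cast this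
    rw [le_div_iff₀ hpos, one_mul]
    exact hdR.le
  have h2 : ∑ d ∈ box.filter (fun d => (∏ i, (d i : ℝ)) < R), R / ∏ i, (d i : ℝ) ≤
      ∑ d ∈ box, R / ∏ i, (d i : ℝ) :=
    Finset.sum_le_sum_of_subset_of_nonneg (Finset.filter_subset _ _) fun d _ _ => by positivity
  have h3 : ∑ d ∈ box, R / ∏ i, (d i : ℝ) = R * ∏ _i : Fin k, ∑ a ∈ Finset.Icc 1 ⌊R⌋₊, ((a : ℕ) : ℝ)⁻¹ := by
    rw [Finset.prod_univ_sum, Finset.mul_sum]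
    refine Finset.sum_congr rfl fun d _ => ?_
    rw [div_eq_mul_inv, ← Finset.prod_inv_distrib]
  have h4 : ∏ _i : Fin k, ∑ a ∈ Finset.Icc 1 ⌊R⌋₊, ((a : ℕ) : ℝ)⁻¹ ≤ (1 + Real.log R) ^ k := by
    rw [Finset.prod_const, Finset.card_univ, Fintype.card_fin]
    refine pow_le_pow_left₀ (Finset.sum_nonneg fun a _ => by positivity) ?_ k
    refine (sum_Icc_inv_le_one_add_log ⌊R⌋₊).trans ?_
    rcases Nat.eq_zero_or_pos ⌊R⌋₊ with h0 | hpos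
    · rw [h0, Nat.cast_zero, Real.log_zero]; linarith [Real.log_nonneg hR]
    · have : Real.log (⌊R⌋₊ : ℝ) ≤ Real.log R :=
        Real.log_le_log (by exact_mod_cast hpos) (Nat.floor_le hR0.le)
      linarith
  calc (#(box.filter fun d => (∏ i, (d i : ℝ)) < R) : ℝ)
      ≤ ∑ d ∈ box, R / ∏ i, (d i : ℝ) := h1.trans h2
    _ = R * ∏ _i : Fin k, ∑ a ∈ Finset.Icc 1 ⌊R⌋₊, ((a : ℕ) : ℝ)⁻¹ := h3
    _ ≤ R * (1 + Real.log R) ^ k := mul_le_mul_of_nonneg_left h4 hR0.le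

/-- Hence `#{d ∈ 𝒟_k(𝓛) : ∏ dᵢ < R} ≤ R (1 + log R)^k` (`R ≥ 1`) — the number of `d` with `λ_d ≠ 0`
for `F = F_k`. [cite: Maynard2016DenseClusters, Lemma 8.5 (iii), proof p. 17; FordGreenKonyaginMaynardTao2018, (7.5) p. 21] -/
theorem card_dkBox_filter_prod_lt_le (L : Fin k → ℤ × ℤ) (B : ℕ) {R : ℝ} (hR : 1 ≤ R) :
    (#((dkBox L B R).filter fun d => (∏ i, (d i : ℝ)) < R) : ℝ) ≤ R * (1 + Real.log R) ^ k := by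
  classical
  refine le_trans ?_ (card_box_filter_prod_lt_le (k := k) hR)
  exact_mod_cast Finset.card_le_card (Finset.filter_subset_filter _ (by
    unfold dkBox; exact Finset.filter_subset _ _))

end Literature.NumberTheory.Sieve.FGKMT2018
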